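import Summits.BirchSwinnertonDyer.BirchSwinnertonDyer.Theorems.GenusKolyvaginAtTwoVisiblePairAtTwoHeegnerClassKummer
import Summits.BirchSwinnertonDyer.Rank1Residual.JET.GrossProp53Kolyvagin
import Summits.BirchSwinnertonDyer.Rank1Residual.X11b.RingClassFieldConj
import HarnessLib

/-!
# Route `GenusKolyvaginAtTwo`, U-half `ShaCardDvdPowAtTwoR` (stmt-BirchSwinnertonDyer-28029) / crux Q3 (22137):
# Gross's Prop. 5.3 for `y_K = P(1) ∈ E(K)` — `τ y_K + w(E) y_K` is torsion — DISCHARGED, and Kolyvagin's `M₀` in Kummer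
# currency WITHOUT the displayed `h53` of `…VisiblePairAtTwoHeegnerClassKummer`

Helper (seat `bsd-line-gk2-p3` g13; `--supports`, closes nothing). `…HeegnerClassKummer.exists_kummer_class_of_pow_smul_eq_derivedPoint`
(p650775) displayed Gross's Prop. 5.3 for the descended point `P₀ ∈ E(K)` of `P(1)` (hypothesis `h53`). It follows from the
tree: Prop. 5.3 for `y(1) ∈ E(K[1])` is `JET.exists_mem_ringClassGal_isOfFinAddOrder_conj_sub_smul` (conductor `1`:
`τ y(1) = ε σ' y(1) + torsion`, `ε = −w(E)`), `P(1) = Σ_{s ∈ Gal(K[1]/K)} s y(1)` (`derivedPoint_one`,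
`bottomTorsion_mem_S_iff`), and conjugation normalises `Gal(K[1]/K)` (`X11b.RingClassFieldConj`): summing,
`τ P(1) = ε P(1) + torsion`; then transport along the injection `E(K) ↪ E(K[1])`, under which `sigmaQ` (the non-trivial
automorphism of `K`) is the restriction of `τ` (both are complex conjugation under `ι`).

* `isOfFinAddOrder_conj_derivedPoint_one_sub` — **`τ P(1) − (−w(E)) P(1)` has finite order in `E(K[1])`** for every
  `τ ∈ Aut_ℚ(K[1])` acting as complex conjugation;
* `algebraMap_sigmaQ_eq_conj` — `algebraMap K K[1] (σ_K k) = τ (algebraMap K K[1] k)`;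
* `isOfFinAddOrder_map_sigmaQ_sub_of_map_eq_derivedPoint` — **the input `h53`**: `σ_K P₀ − (−w(E)) P₀` has finite order
  for every `P₀ ∈ E(K)` above `P(1)`;
* `exists_kummer_class_of_pow_smul_eq_derivedPoint'` — p650775's theorem with `h53` discharged: from the crux binders
  (`2^{M₀} ∥ P(1)` in `E(K[1])`) on the habitat, `∃ x ∈ H¹(ℚ, E[2^M])` with `res x` Selmer over `K`, `2^{M−1} x ≠ 0`,
  `2^{M₀}·res x = c_M(1)`.

THEOREMS ONLY (no definition, no named fact, no `sorry`, standard axioms). BSD is not proved by any of this.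

References: [GrossLMS1991] §3 (τ on K_n), §4 (P_1 = y_K), §5 Prop. 5.3; [Cox2013] Lemma 9.3; [McCallumLMS1991] §5 (p. 303).
-/

set_option autoImplicit false
set_option linter.dupNamespace false -- tree convention: `Summit.BirchSwinnertonDyer.BirchSwinnertonDyer.Theorems` (summit = sub-problem)

noncomputable section

open scoped Classical

namespace Summit.BirchSwinnertonDyer.BirchSwinnertonDyer.Theorems.GenusExact.VisiblePairAtTwo

open WeierstrassCurve NumberField IsDedekindDomain Field
open Literature.NumberTheory.EllipticCurves Literature.NumberTheory.GaloisRepresentations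
open Literature.NumberTheory.EllipticCurves.ModularForms
open Summit.BirchSwinnertonDyer.Rank1Residual.JET Summit.BirchSwinnertonDyer.Rank1Residual.X11b
open Summit.BirchSwinnertonDyer.Rank1Residual.X11b.RingClassConj

variable (W : WeierstrassCurve ℚ) [W.IsElliptic] [NeZero (W.conductorNorm ℤ)]
  (K : Type) [Field K] [NumberField K] {Dt : ModularParametrizationData W (W.conductorNorm ℤ)} {β : ℤ} {ι : K →+* ℂ}

/-! ## §1 Prop. 5.3 for `P(1)` in `E(K[1])` -/

/-- **`τ P(1) − (−w(E))·P(1)` is torsion in `E(K[1])`** for `τ` acting as complex conjugation on `K[1] ⊂ ℂ`: sum Gross's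
Prop. 5.3 for `y(1)` (`τ y(1) = ε σ' y(1) + t`, `t` torsion) over `P(1) = Σ_{s ∈ Gal(K[1]/K)} s y(1)`, reindexing by
`s ↦ τ s τ⁻¹ σ'`. [cite: GrossLMS1991, §5 Prop. 5.3 and §4 (P_1 = y_K)] [cite: Cox2013, Lemma 9.3] -/
theorem isOfFinAddOrder_conj_derivedPoint_one_sub (hK : IsImaginaryQuadratic K)
    (hH : SatisfiesHeegnerHypothesis (W.conductorNorm ℤ) K) (d : KolyvaginHeegnerData Dt β ι 1)
    {τ : ringClassField K ι 1 ≃ₐ[ℚ] ringClassField K ι 1}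
    (hτ : ∀ x : ringClassField K ι 1, ((τ x : ringClassField K ι 1) : ℂ) = starRingEnd ℂ x) :
    IsOfFinAddOrder (pointGalHom W (ringClassField K ι 1) τ d.derivedPoint - (-W.rootNumber) • d.derivedPoint) := by
  obtain ⟨σ', hσ', hfin⟩ := exists_mem_ringClassGal_isOfFinAddOrder_conj_sub_smul W hK hH Dt ι one_ne_zero
    (Nat.coprime_one_left _) d τ hτ
  set ρ := pointGalHom W (ringClassField K ι 1) with hρ
  set ε : ℤ := -W.rootNumber with hε
  set t := ρ τ d.y - ε • ρ σ' d.y with ht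
  have hmul : ∀ (a b : ringClassField K ι 1 ≃ₐ[ℚ] ringClassField K ι 1) (P : (W.baseChange (ringClassField K ι 1)).toAffine.Point),
      ρ (a * b) P = ρ a (ρ b P) := fun a b P ↦ by rw [map_mul]; rfl
  have hS : ∀ s, s ∈ d.S ↔ s ∈ ringClassGal ι 1 := fun s ↦ bottomTorsion_mem_S_iff d
  -- each summand
  have hterm : ∀ s : ringClassField K ι 1 ≃ₐ[ℚ] ringClassField K ι 1,
      ρ τ (ρ s d.y) = ρ (τ * s * τ⁻¹) t + ε • ρ (τ * s * τ⁻¹ * σ') d.y := by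
    intro s
    have hy : ρ τ d.y = t + ε • ρ σ' d.y := by rw [ht, sub_add_cancel]
    calc ρ τ (ρ s d.y) = ρ (τ * s * τ⁻¹) (ρ τ d.y) := by rw [← hmul, ← hmul, inv_mul_cancel_right]
      _ = ρ (τ * s * τ⁻¹) t + ε • ρ (τ * s * τ⁻¹ * σ') d.y := by rw [hy, map_add, map_zsmul, ← hmul]
  -- the sum
  have hkey : ρ τ d.derivedPoint = (∑ s ∈ d.S, ρ (τ * s * τ⁻¹) t) + ε • d.derivedPoint := by
    conv_lhs => rw [d.derivedPoint_one, map_sum]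
    simp_rw [← hρ, hterm, Finset.sum_add_distrib, ← Finset.smul_sum]
    congr 1
    rw [d.derivedPoint_one]
    refine congrArg (ε • ·) ?_
    refine Finset.sum_nbij' (fun s ↦ τ * s * τ⁻¹ * σ') (fun g ↦ τ⁻¹ * g * σ'⁻¹ * τ) (fun s hs ↦ ?_)
      (fun g hg ↦ ?_) (fun s _ ↦ by group) (fun g _ ↦ by group) (fun s _ ↦ rfl)
    · exact (hS _).mpr (mul_mem (conj_mul_mul_inv_mem_ringClassGal hτ hK ((hS _).mp hs)) hσ')
    · have h1 : τ * (g * σ'⁻¹) * τ⁻¹ ∈ ringClassGal ι 1 :=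
        conj_mul_mul_inv_mem_ringClassGal hτ hK (mul_mem ((hS _).mp hg) (inv_mem hσ'))
      rw [Summit.BirchSwinnertonDyer.Rank1Residual.X11b.RingClassConj.conj_inv hτ] at h1 ⊢
      refine (hS _).mpr ?_
      simpa only [mul_assoc] using h1
  -- the torsion term
  have hT : IsOfFinAddOrder (∑ s ∈ d.S, ρ (τ * s * τ⁻¹) t) := by
    obtain ⟨n, hn, hn0⟩ := hfin.exists_nsmul_eq_zero
    refine isOfFinAddOrder_iff_nsmul_eq_zero.mpr ⟨n, hn, ?_⟩
    rw [Finset.smul_sum]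
    refine Finset.sum_eq_zero fun s _ ↦ ?_
    rw [← map_nsmul, hn0, map_zero]
  rw [hkey, add_sub_cancel_right]
  exact hT

/-! ## §2 Transport to `E(K)` -/

/-- **`σ_K` is the restriction of `τ`**: `algebraMap K K[1] (σ_K k) = τ (algebraMap K K[1] k)` for the non-trivial
automorphism `σ_K = sigmaQ` of the imaginary quadratic `K` and any `τ` acting as complex conjugation on `K[n] ⊂ ℂ` (both
sides are `conj (ι k)`: `Aut_ℚ(K) = {1, σ_K}` and `conj ∘ ι = ι ∘ c` with `c ≠ 1`, `K` totally complex). [folklore]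
[cite: GrossLMS1991, §5 (Gal(K/ℚ) = ⟨1, τ⟩)] -/
theorem algebraMap_sigmaQ_eq_conj (hK : IsImaginaryQuadratic K) {θ : K} (hθ : θ ∉ Set.range (algebraMap ℚ K))
    {c₀ : ℚ} (hθsq : θ ^ 2 = algebraMap ℚ K c₀) {n : ℕ}
    {τ : ringClassField K ι n ≃ₐ[ℚ] ringClassField K ι n}
    (hτ : ∀ x : ringClassField K ι n, ((τ x : ringClassField K ι n) : ℂ) = starRingEnd ℂ x) (k : K) :
    algebraMap K (ringClassField K ι n) (sigmaQ K hK.1 hθ hθsq k) = τ (algebraMap K (ringClassField K ι n) k) := by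
  obtain ⟨c, hc⟩ := exists_algEquiv_comp_eq_conjugate hK ι
  -- `c ≠ 1` (`ι` is not real) and `Aut_ℚ(K)` has two elements, so `c = σ_K`
  have hc1 : c ≠ 1 := by
    haveI := hK.2
    intro h1
    rw [h1] at hc
    refine IsTotallyComplex.complexEmbedding_not_isReal ι (ComplexEmbedding.isReal_iff.mpr ?_)
    rw [← hc]
    exact RingHom.ext fun x ↦ rfl
  haveI : IsGalois ℚ K := isGalois_of_finrank_eq_two K hK.1
  have hcard : Nat.card (K ≃ₐ[ℚ] K) = 2 := by rw [IsGalois.card_aut_eq_finrank, hK.1]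
  obtain ⟨y, -, hy⟩ := (Nat.card_eq_two_iff' (1 : K ≃ₐ[ℚ] K)).mp hcard
  have hcσ : c = sigmaQ K hK.1 hθ hθsq := (hy c hc1).trans (hy _ (sigmaQ_ne_one K hK.1 hθ hθsq)).symm
  apply Subtype.ext
  rw [hτ, coe_algebraMap_ringClassField, coe_algebraMap_ringClassField, ← hcσ,
    ← ComplexEmbedding.conjugate_coe_eq, ← hc]
  rfl

/-- **Gross's Prop. 5.3 for the descended point (the input `h53` of `…HeegnerClassKummer`)**: for every `P₀ ∈ E(K)` mapping
to `P(1)`, `σ_K P₀ − (−w(E))·P₀` has finite order (`E(K) ↪ E(K[1])` is injective and intertwines `σ_K` with `τ`).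
[cite: GrossLMS1991, §5 Prop. 5.3] -/
theorem isOfFinAddOrder_map_sigmaQ_sub_of_map_eq_derivedPoint (hK : IsImaginaryQuadratic K)
    (hH : SatisfiesHeegnerHypothesis (W.conductorNorm ℤ) K) {θ : K} (hθ : θ ∉ Set.range (algebraMap ℚ K))
    {c₀ : ℚ} (hθsq : θ ^ 2 = algebraMap ℚ K c₀) (d : KolyvaginHeegnerData Dt β ι 1)
    (P₀ : (W.baseChange K).toAffine.Point)
    (hP₀ : WeierstrassCurve.Affine.Point.map (W' := W) (algebraMap K (ringClassField K ι 1)).toRatAlgHom P₀ =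
      d.derivedPoint) :
    IsOfFinAddOrder (WeierstrassCurve.Affine.Point.map (W' := W) (sigmaQ K hK.1 hθ hθsq : K →ₐ[ℚ] K) P₀ -
      (-W.rootNumber) • P₀) := by
  obtain ⟨τ, hτ⟩ := exists_conj_algEquiv hK ι (n := 1) one_ne_zero
  set f : K →ₐ[ℚ] ringClassField K ι 1 := (algebraMap K (ringClassField K ι 1)).toRatAlgHom with hf
  have hcomp : f.comp (sigmaQ K hK.1 hθ hθsq : K →ₐ[ℚ] K) =
      (τ : ringClassField K ι 1 →ₐ[ℚ] ringClassField K ι 1).comp f :=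
    AlgHom.ext fun k ↦ algebraMap_sigmaQ_eq_conj K hK hθ hθsq hτ k
  have hmapf : WeierstrassCurve.Affine.Point.map (W' := W) f
      (WeierstrassCurve.Affine.Point.map (W' := W) (sigmaQ K hK.1 hθ hθsq : K →ₐ[ℚ] K) P₀ - (-W.rootNumber) • P₀) =
      pointGalHom W (ringClassField K ι 1) τ d.derivedPoint - (-W.rootNumber) • d.derivedPoint := by
    rw [map_sub, map_zsmul, WeierstrassCurve.Affine.Point.map_map, hcomp, ← WeierstrassCurve.Affine.Point.map_map,
      hP₀, pointGalHom_apply]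
  have hfin := isOfFinAddOrder_conj_derivedPoint_one_sub W K hK hH d hτ
  rw [← hmapf] at hfin
  obtain ⟨m, hm, hm0⟩ := hfin.exists_nsmul_eq_zero
  refine isOfFinAddOrder_iff_nsmul_eq_zero.mpr ⟨m, hm, ?_⟩
  apply WeierstrassCurve.Affine.Point.map_injective (f := f)
  rw [map_nsmul, hm0, map_zero]

/-! ## §3 Kolyvagin's `M₀` in Kummer currency, `h53` discharged -/

/-- **Kolyvagin's `M₀` in Kummer currency, unconditional on the habitat** (`E` globally minimal, `ρ̄_{E,2}` onto,
`K = ℚ(θ)` imaginary quadratic with `θ² = d_K` odd, Heegner hypothesis, `w(E) = −1`, `M ≥ 1`): from `2^{M₀} Q₁ = P(1)`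
solvable in `E(K[1])` and `2^{M₀+1} Q = P(1)` not, there is `x ∈ H¹(ℚ, E[2^M])` with `res x ∈ Sel^{(2^M)}(E/K)`,
`2^{M−1} x ≠ 0` and `2^{M₀}·res x = c_M(1)` — `…HeegnerClassKummer.exists_kummer_class_of_pow_smul_eq_derivedPoint` with its
`h53` supplied by `isOfFinAddOrder_map_sigmaQ_sub_of_map_eq_derivedPoint`. [cite: McCallumLMS1991, §5 (p. 303)]
[cite: GrossLMS1991, §4 (4.4), §5 Prop. 5.3] -/
theorem exists_kummer_class_of_pow_smul_eq_derivedPoint' [W.IsGloballyMinimal] (hK : IsImaginaryQuadratic K)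
    (hodd : Odd (NumberField.discr K)) (hH : SatisfiesHeegnerHypothesis (W.conductorNorm ℤ) K)
    (hs : W.HasSurjectiveModNGaloisRep 2) {θ : K} (hθ : θ ∉ Set.range (algebraMap ℚ K))
    (hθsq : θ ^ 2 = algebraMap ℚ K ((NumberField.discr K : ℤ) : ℚ)) (hw : W.rootNumber = -1) {M : ℕ} (hM : 1 ≤ M)
    (d₁ : KolyvaginHeegnerData Dt β ι 1) {M₀ : ℕ}
    (hdiv : ∃ Q : (W.baseChange (ringClassField K ι 1)).toAffine.Point, ((2 ^ M₀ : ℕ) : ℤ) • Q = d₁.derivedPoint)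
    (hndiv : ¬ ∃ Q : (W.baseChange (ringClassField K ι 1)).toAffine.Point,
      ((2 ^ (M₀ + 1) : ℕ) : ℤ) • Q = d₁.derivedPoint) :
    ∃ x : galH1Torsion W (lvl M), resTorsion W K (lvl M) x ∈ selmerGroup (W.baseChange K) (lvl M) ∧
      ((2 : ℤ) ^ (M - 1)) • x ≠ 0 ∧
      ((2 : ℤ) ^ M₀) • resTorsion W K (lvl M) x = d₁.kolyvaginClass Nat.prime_two M :=
  exists_kummer_class_of_pow_smul_eq_derivedPoint W K hK hodd hH hs hθ hθsq hw hM d₁ hdiv hndiv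
    fun P₀ hP₀ ↦ isOfFinAddOrder_map_sigmaQ_sub_of_map_eq_derivedPoint W K hK hH hθ hθsq d₁ P₀ hP₀

end Summit.BirchSwinnertonDyer.BirchSwinnertonDyer.Theorems.GenusExact.VisiblePairAtTwo

end
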